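import Summits.KontsevichZagierPeriods.Zeta5Search.Certificates.TwoTaleTelescopeLeading

/-!
# ζ(2) two-tale line — the Ω-INDUCTION skeleton of fam-tele's parametric (bmiss) proof (cell `pub-zeta5`, certifier `cert-2`)

HONEST FRAMING: systematic search; recurrence certificates; no irrationality claim unless certified.

fam-tele gen 3 (`certs/tele/bmiss_general/PROOF.md` §1) proves Zudilin's two-tale identity `I_L(p) = I_R(p)` for every
`p = (a,b,e,f,g)` in the region `Ω ⊂ ℤ⁵` by well-founded induction: whenever some step direction
`δ ∈ {g,b,e,f,a,aef,bg}` is CERTIFIED at the base point `p₀ = p − 3δ` (the four points `p₀ + kδ`, `k ≤ 3`, lie in `Ω` and the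
contour bookkeeping (S2) holds), the order-3 step relations `Σ_{k≤3} c_k(p₀)·I_X(p₀+kδ) = 0` (`X = L, R`; from the telescoping
identities (S1) = the tree's `telescope_*` theorems plus the analytic contour shift) with `c₃(p₀) ≠ 0` ((S3) = the tree's
`TwoTaleTelescopeLeading`) transport `I_L = I_R` from the three predecessors to `p`; the remaining points form the finite BASE.
This file is the COMBINATORIAL layer only, with the analytic step as a hypothesis: `omega_induction` — for any function
`D : (Fin 5 → ℤ) → F` (think `D = I_L − I_R`), any integer coefficients `c δ p₀ k` and any legitimacy predicate, if `D` vanishes on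
the base points, the certified step relations hold and the certified leading coefficients are non-zero, then `D = 0` on `Ω`
(induction on `a+b+e+f+g`: every direction is a non-zero non-negative vector); `eq_on_Omega` is the two-function form.
Plus the glue `c<D>3_ne_zero_of_Omega` deriving the hypotheses of `TwoTaleTelescopeLeading` from membership in `Ω` for the
directions `g, b, e, f, bg` (and the linear part for `a`). Nothing analytic is proved here.
-/

namespace Summit.KontsevichZagierPeriods.Zeta5Search.Certificates

namespace TwoTaleTelescope

open Finset

/-- Points `p = (a,b,e,f,g) ∈ ℤ⁵` as functions `Fin 5 → ℤ` (`p 0 = a`, `p 1 = b`, `p 2 = e`, `p 3 = f`, `p 4 = g`). -/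
abbrev Pt := Fin 5 → ℤ

/-- Zudilin's / fam-tele's admissible region `Ω ⊂ ℤ⁵` (PROOF.md §0), as a set: all coordinates `≥ 1`, `2e ≥ a+1`, `2f ≥ a+1`, `e ≤ a`, `f ≤ a`,
`2·max(e,f) ≥ a+3`, `b ≥ a − min(e,f) + 1`, `g ≥ max(a,b)+1`, `g ≥ b+3`, `g ≤ 2e+2f+b−a−1`. -/
def Omega : Set Pt :=
  {p | 1 ≤ p 0 ∧ 1 ≤ p 1 ∧ 1 ≤ p 2 ∧ 1 ≤ p 3 ∧ 1 ≤ p 4 ∧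
    p 0 + 1 ≤ 2 * p 2 ∧ p 0 + 1 ≤ 2 * p 3 ∧ p 2 ≤ p 0 ∧ p 3 ≤ p 0 ∧ (p 0 + 3 ≤ 2 * p 2 ∨ p 0 + 3 ≤ 2 * p 3) ∧
    p 0 + 1 ≤ p 1 + p 2 ∧ p 0 + 1 ≤ p 1 + p 3 ∧ p 0 + 1 ≤ p 4 ∧ p 1 + 3 ≤ p 4 ∧ p 4 ≤ 2 * p 2 + 2 * p 3 + p 1 - p 0 - 1}

/-- Membership in `Ω`, unfolded (conjuncts in the order of the definition: `1 ≤ a, 1 ≤ b, 1 ≤ e, 1 ≤ f, 1 ≤ g, a+1 ≤ 2e, a+1 ≤ 2f,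
e ≤ a, f ≤ a, a+3 ≤ 2e ∨ a+3 ≤ 2f, a+1 ≤ b+e, a+1 ≤ b+f, a+1 ≤ g, b+3 ≤ g, g ≤ 2e+2f+b−a−1`). -/
theorem mem_Omega {p : Pt} : p ∈ Omega ↔ (1 ≤ p 0 ∧ 1 ≤ p 1 ∧ 1 ≤ p 2 ∧ 1 ≤ p 3 ∧ 1 ≤ p 4 ∧
    p 0 + 1 ≤ 2 * p 2 ∧ p 0 + 1 ≤ 2 * p 3 ∧ p 2 ≤ p 0 ∧ p 3 ≤ p 0 ∧ (p 0 + 3 ≤ 2 * p 2 ∨ p 0 + 3 ≤ 2 * p 3) ∧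
    p 0 + 1 ≤ p 1 + p 2 ∧ p 0 + 1 ≤ p 1 + p 3 ∧ p 0 + 1 ≤ p 4 ∧ p 1 + 3 ≤ p 4 ∧ p 4 ≤ 2 * p 2 + 2 * p 3 + p 1 - p 0 - 1) :=
  Iff.rfl

/-- Direction `g`. -/
def dirG : Pt := ![0, 0, 0, 0, 1]
/-- Direction `b`. -/
def dirB : Pt := ![0, 1, 0, 0, 0]
/-- Direction `e`. -/
def dirE : Pt := ![0, 0, 1, 0, 0]
/-- Direction `f`. -/
def dirF : Pt := ![0, 0, 0, 1, 0]
/-- Direction `a`. -/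
def dirA : Pt := ![1, 0, 0, 0, 0]
/-- Direction `aef`. -/
def dirAEF : Pt := ![1, 0, 1, 1, 0]
/-- Direction `bg`. -/
def dirBG : Pt := ![0, 1, 0, 0, 1]

/-- The seven step directions of the Ω-induction (PROOF.md §1). -/
def dirs : List Pt := [dirG, dirB, dirE, dirF, dirA, dirAEF, dirBG]

/-- The size `a+b+e+f+g` used as the induction measure. -/
def psum (p : Pt) : ℤ := p 0 + p 1 + p 2 + p 3 + p 4

/-- Every direction is componentwise non-negative with positive size. -/
theorem dirs_pos : ∀ δ ∈ dirs, (∀ i, 0 ≤ δ i) ∧ 1 ≤ psum δ := by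
  intro δ hδ
  simp only [dirs, List.mem_cons, List.mem_nil_iff, or_false] at hδ
  rcases hδ with rfl | rfl | rfl | rfl | rfl | rfl | rfl <;>
    refine ⟨fun i => ?_, by simp [psum, dirG, dirB, dirE, dirF, dirA, dirAEF, dirBG]⟩ <;>
    fin_cases i <;> simp [dirG, dirB, dirE, dirF, dirA, dirAEF, dirBG]

/-- Points of `Ω` have positive size. -/
theorem psum_pos_of_Omega {p : Pt} (h : p ∈ Omega) : 1 ≤ psum p := by
  obtain ⟨h0, h1, h2, h3, h4, -⟩ := mem_Omega.mp h
  unfold psum; linarith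

/-- The base points `p₀` of CERTIFIED steps in direction `δ`: a listed direction, the four points `p₀ + kδ` (`k ≤ 3`) in `Ω`,
and the legitimacy predicate `Legit δ p₀` (the contour bookkeeping (S2) of PROOF.md §4, kept abstract here). -/
def StepBase (Legit : Pt → Pt → Prop) (δ : Pt) : Set Pt :=
  {p₀ | δ ∈ dirs ∧ (∀ k : ℕ, k ≤ 3 → p₀ + (k : ℤ) • δ ∈ Omega) ∧ Legit δ p₀}

/-- BASE points: points of `Ω` not reached by any certified step (PROOF.md §1/§5: the rule-less points and EXC). -/
def Base (Legit : Pt → Pt → Prop) : Set Pt :=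
  {p | p ∈ Omega ∧ ∀ δ ∈ dirs, p - (3 : ℤ) • δ ∉ StepBase Legit δ}

/-- **The Ω-induction** (PROOF.md §1, combinatorial layer). For a function `D` on `ℤ⁵` with values in a field (think `I_L − I_R`),
integer step coefficients `c δ p₀ k` and a legitimacy predicate: if `D` vanishes on the base points, every certified step relation
`Σ_{k≤3} c δ p₀ k · D(p₀ + kδ) = 0` holds and every certified leading coefficient `c δ p₀ 3` is non-zero, then `D` vanishes on `Ω`. -/
theorem omega_induction {F : Type*} [Field F] (Legit : Pt → Pt → Prop) (c : Pt → Pt → ℕ → ℤ) (D : Pt → F)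
    (hbase : ∀ p ∈ Base Legit, D p = 0)
    (hstep : ∀ δ, ∀ p₀ ∈ StepBase Legit δ, ∑ k ∈ range 4, (c δ p₀ k : F) * D (p₀ + (k : ℤ) • δ) = 0)
    (hc3 : ∀ δ, ∀ p₀ ∈ StepBase Legit δ, (c δ p₀ 3 : F) ≠ 0) :
    ∀ p ∈ Omega, D p = 0 := by
  -- strong induction on the natural number `(psum p).toNat`
  suffices H : ∀ n : ℕ, ∀ p ∈ Omega, (psum p).toNat = n → D p = 0 from fun p hp => H _ p hp rfl
  intro n
  induction n using Nat.strong_induction_on with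
  | _ n ih =>
    intro p hp hn
    by_cases hex : ∃ δ ∈ dirs, p - (3 : ℤ) • δ ∈ StepBase Legit δ
    · -- some certified step reaches `p`
      obtain ⟨δ, hδ, hst⟩ := hex
      set p₀ : Pt := p - (3 : ℤ) • δ with hp₀
      have hp3 : p₀ + ((3 : ℕ) : ℤ) • δ = p := by rw [hp₀]; push_cast; abel
      obtain ⟨-, hsz⟩ := dirs_pos δ hδ
      have hstΩ := hst.2.1
      -- the three predecessors are smaller and in Ω, hence `D = 0` there
      have hpred : ∀ k : ℕ, k < 3 → D (p₀ + (k : ℤ) • δ) = 0 := by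
        intro k hk
        have hΩk : p₀ + (k : ℤ) • δ ∈ Omega := hstΩ k (by omega)
        refine ih ((psum (p₀ + (k : ℤ) • δ)).toNat) ?_ _ hΩk rfl
        have e1 : psum (p₀ + (k : ℤ) • δ) = psum p - (3 - (k : ℤ)) * psum δ := by
          simp only [hp₀, psum, Pi.add_apply, Pi.sub_apply, Pi.smul_apply, smul_eq_mul]; ring
        have h1 : 1 ≤ psum (p₀ + (k : ℤ) • δ) := psum_pos_of_Omega hΩk
        have hk' : (k : ℤ) < 3 := by exact_mod_cast hk
        have hlt : psum (p₀ + (k : ℤ) • δ) < psum p := by rw [e1]; nlinarith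
        rw [← hn]
        exact (Int.toNat_lt_toNat (by linarith)).mpr hlt
      -- the step relation determines `D p`
      have hrel := hstep δ p₀ hst
      rw [Finset.sum_range_succ, Finset.sum_range_succ, Finset.sum_range_succ, Finset.sum_range_one,
        hpred 0 (by omega), hpred 1 (by omega), hpred 2 (by omega), hp3] at hrel
      simp only [mul_zero, zero_add] at hrel
      exact (mul_eq_zero.mp hrel).resolve_left (hc3 δ p₀ hst)
    · -- no certified step reaches `p`: a base point
      exact hbase p ⟨hp, fun δ hδ hs => hex ⟨δ, hδ, hs⟩⟩

/-- Two-function form of `omega_induction` (PROOF.md §1, STEP LEMMA ⇒ THEOREM): if `I_L = I_R` on the base points and both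
`I_L` and `I_R` satisfy the certified step relations with the SAME integer coefficients and non-zero leading coefficient, then
`I_L = I_R` on `Ω`. (For `aef` on the `R` side PROOF.md §3 has an extra non-zero scalar `h_R(p₀)`; divide it out first.) -/
theorem eq_on_Omega {F : Type*} [Field F] (Legit : Pt → Pt → Prop) (c : Pt → Pt → ℕ → ℤ) (IL IR : Pt → F)
    (hbase : ∀ p ∈ Base Legit, IL p = IR p)
    (hL : ∀ δ, ∀ p₀ ∈ StepBase Legit δ, ∑ k ∈ range 4, (c δ p₀ k : F) * IL (p₀ + (k : ℤ) • δ) = 0)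
    (hR : ∀ δ, ∀ p₀ ∈ StepBase Legit δ, ∑ k ∈ range 4, (c δ p₀ k : F) * IR (p₀ + (k : ℤ) • δ) = 0)
    (hc3 : ∀ δ, ∀ p₀ ∈ StepBase Legit δ, (c δ p₀ 3 : F) ≠ 0) :
    ∀ p ∈ Omega, IL p = IR p := by
  intro p hp
  have h := omega_induction Legit c (fun q => IL q - IR q) (fun q hq => sub_eq_zero.mpr (hbase q hq))
    (fun δ p₀ hs => by simp only [mul_sub, Finset.sum_sub_distrib, hL δ p₀ hs, hR δ p₀ hs, sub_zero]) hc3 p hp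
  exact sub_eq_zero.mp h

/-! ### Glue: (S3) from `Ω`-membership for the generic directions -/

/-- `c₃ ≠ 0` for direction `g` whenever the base point is in `Ω`. -/
theorem cG3_ne_zero_of_Omega (p₀ : Pt) (h : p₀ ∈ Omega) : spvalC cG3 (p₀ 0) (p₀ 1) (p₀ 2) (p₀ 3) (p₀ 4) ≠ 0 := by
  obtain ⟨-, -, -, -, -, -, -, h2, h3, -, -, -, h12, h13, -⟩ := mem_Omega.mp h
  exact cG3_ne_zero _ _ _ _ _ (by linarith) (by linarith) h2 h3

/-- `c₃ ≠ 0` for direction `b` whenever the base point is in `Ω`. -/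
theorem cB3_ne_zero_of_Omega (p₀ : Pt) (h : p₀ ∈ Omega) : spvalC cB3 (p₀ 0) (p₀ 1) (p₀ 2) (p₀ 3) (p₀ 4) ≠ 0 :=
  cB3_ne_zero _ _ _ _ _ (by have := (mem_Omega.mp h).2.2.2.2.2.2.2.2.2.2.2.2.2.2; linarith)

/-- `c₃ ≠ 0` for direction `e` whenever the base point is in `Ω`. -/
theorem cE3_ne_zero_of_Omega (p₀ : Pt) (h : p₀ ∈ Omega) : spvalC cE3 (p₀ 0) (p₀ 1) (p₀ 2) (p₀ 3) (p₀ 4) ≠ 0 :=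
  cE3_ne_zero _ _ _ _ _ (by have := (mem_Omega.mp h).2.2.2.2.2.2.2.2.2.2.2.2.2.2; linarith)

/-- `c₃ ≠ 0` for direction `f` whenever the base point is in `Ω`. -/
theorem cF3_ne_zero_of_Omega (p₀ : Pt) (h : p₀ ∈ Omega) : spvalC cF3 (p₀ 0) (p₀ 1) (p₀ 2) (p₀ 3) (p₀ 4) ≠ 0 :=
  cF3_ne_zero _ _ _ _ _ (by have := (mem_Omega.mp h).2.2.2.2.2.2.2.2.2.2.2.2.2.2; linarith)

/-- `c₃ ≠ 0` for direction `bg` whenever the base point is in `Ω`. -/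
theorem cBg3_ne_zero_of_Omega (p₀ : Pt) (h : p₀ ∈ Omega) : spvalC cBg3 (p₀ 0) (p₀ 1) (p₀ 2) (p₀ 3) (p₀ 4) ≠ 0 := by
  obtain ⟨-, -, -, -, -, -, -, h2, h3, -, -, -, h12, -, -⟩ := mem_Omega.mp h
  exact cBg3_ne_zero _ _ _ _ _ (by linarith) h2 h3

/-- The linear hypotheses of `cA3_ne_zero` hold whenever the TARGET `p₀ + 3·(1,0,0,0,0)` is in `Ω`
(the a-rule-domain parametrisation of `K` remains a separate hypothesis: PROOF.md Lemma C2). -/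
theorem cA3_linear_of_Omega (p₀ : Pt) (h : p₀ + (3 : ℤ) • dirA ∈ Omega) :
    p₀ 0 + 4 ≤ p₀ 1 + p₀ 2 ∧ p₀ 0 + 4 ≤ p₀ 1 + p₀ 3 ∧ p₀ 0 + 4 ≤ 2 * p₀ 2 ∧ p₀ 0 + 4 ≤ 2 * p₀ 3 ∧
      p₀ 0 + 4 ≤ p₀ 2 + p₀ 3 := by
  obtain ⟨-, -, -, -, -, h5, h6, -, -, -, h10, h11, -, -, -⟩ := mem_Omega.mp h
  simp only [dirA, Pi.add_apply, Pi.smul_apply, smul_eq_mul] at h5 h6 h10 h11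
  simp [Matrix.cons_val] at h5 h6 h10 h11
  refine ⟨by linarith, by linarith, by linarith, by linarith, by linarith⟩

end TwoTaleTelescope

end Summit.KontsevichZagierPeriods.Zeta5Search.Certificates
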